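import Summits.CriticalPhenomena.PercolationContinuityZ3.Theorems.PercNearOneGluingNoHeavyLowerTailStarSetSwapAdmissible
import HarnessLib

/-!
# `NoHeavyLowerTail` (stmt-CriticalPhenomena-4575) — structure of a residual unit (U1-PROOF.md L4.2 / L5.4(b,c); blueprint §G4)

Support file (prover `prim-gen-swap` gen 15; `--supports stmt-CriticalPhenomena-4575`).  No definitions, no named facts, no sorries.

Second step of the RESIDUAL structure theorem of the U1′_r charging scheme.  A charged unit `(S, X)` of the configuration expansion
that is in none of the early families (no r-free triangle in `S`, non-regular, no admissible swap port) and has `y(S) = 0` — so the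
first open forest class `J = J*(S)` exists and is not a child edge — is of one of three types (U1-PROOF.md §5 "RESIDUAL units"):
with `X = {e, ē}`, `J` meets `X` exactly at `e`, and
* (R1)  `J = I₀ = {e, r}` is the leaf class at `r` (`e = q₀`) and the far end `ē` of `X` is COLD (`r ∉ dom X ē`); or
* (R2-C) `J` avoids `r`, `ē` is C-hot (`dom X ē = A(ē) = {r, ē}` a child edge) and the swap is BLOCKED: `J < A(ē)`; or
* (R2-I) `J` avoids `r` and `ē = q₀` is I-hot (`dom X ē = I₀`).
Everything else is swap-admissible (`swap_admissible_I`, `swap_admissible_H` + the credit computation of this file) or regular.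

* `StarSet.swap_target_cred` — the swapped configuration `S − X + A` is a credit configuration, from (Φ1), (Φ3), (Φ4);
* `StarSet.residual_jstar` — the trichotomy.
-/

namespace Summit.CriticalPhenomena.PercolationContinuityZ3.Theorems

open Finset
open scoped BigOperators

namespace StarSet

variable {ι V : Type*} [LinearOrder ι] [DecidableEq V]

/-- **The swapped configuration is a credit configuration** (U1-PROOF.md L5.1, concrete port form): if `A = {r, ē} ∈ F`,
every open forest class lies above `A` (Φ4, so `A` itself is closed), and no chord `μ ≠ X` of `S` through `ē` avoiding `r` is adjacent to the open class `J ≠ X`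
(Φ3), then `S − X + A` has no Ω-chord and its first open forest class is the child edge `A`. -/
theorem swap_target_cred (P P' : ι → V) (r : V) (F : Finset ι) (S : Finset ι) {X J A : ι} {ē : V}
    (hJS : J ∈ S) (hJX : J ≠ X) (hAF : A ∈ F) (hAr : P A = r) (hAē : P' A = ē)
    (hΦ3 : ∀ μ, μ ∉ F → (P μ ≠ r ∧ P' μ ≠ r) → μ ∈ S → μ ≠ X → (P μ = ē ∨ P' μ = ē) →
      ¬ (P J = P μ ∨ P J = P' μ ∨ P' J = P μ ∨ P' J = P' μ))
    (hΦ4 : ∀ I ∈ F, I ∈ S → A < I) :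
    (∀ μ ∈ insert A (S.erase X), μ ∉ F → (P μ ≠ r ∧ P' μ ≠ r) →
        ∃ j ∈ insert A (S.erase X), ¬ (P j = P μ ∨ P j = P' μ ∨ P' j = P μ ∨ P' j = P' μ)) ∧
      ((∀ I ∈ F, I ∉ insert A (S.erase X)) ∨
        ∃ a ∈ F, P a = r ∧ a ∈ insert A (S.erase X) ∧ ∀ b ∈ F, b < a → b ∉ insert A (S.erase X)) := by
  classical
  refine ⟨fun μ hμ hμF hμr => ?_, Or.inr ⟨A, hAF, hAr, mem_insert_self _ _, fun b hbF hbA hb => ?_⟩⟩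
  · have hμA : μ ≠ A := fun h => hμF (h ▸ hAF)
    have hμS : μ ∈ S := mem_of_mem_erase ((mem_insert.1 hμ).resolve_left hμA)
    have hμX : μ ≠ X := ne_of_mem_erase ((mem_insert.1 hμ).resolve_left hμA)
    by_cases hμē : P μ = ē ∨ P' μ = ē
    · exact ⟨J, mem_insert_of_mem (mem_erase.2 ⟨hJX, hJS⟩), hΦ3 μ hμF hμr hμS hμX hμē⟩
    · exact ⟨A, mem_insert_self _ _, chord_far_of_not_mem P P' r ē A μ (Or.inr ⟨hAr, hAē⟩) hμr hμē⟩
  · rcases mem_insert.1 hb with hb | hb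
    · exact absurd hb (ne_of_lt hbA)
    · exact lt_asymm hbA (hΦ4 b hbF (mem_of_mem_erase hb))

/-- **Structure of a residual unit (U1-PROOF.md L4.2, L5.4(b,c)).**  See the file header.  Hypotheses: `X` is an Ω-chord of `S`
(`X ∈ S` a chord avoiding `r`, adjacent to every class of `S`); `S` has no r-free triangle; `y(S) = 0` (`hy`); `hNR` = non-regularity of
the unit at the free end (U1-PROOF (NR), first clause); `hnadm` = no admissible swap port (with the credit predicate unfolded); `J` = the
first open forest class.  Conclusion: `J` is not a child edge, meets `X` at exactly one end `e`, and the trichotomy R1 / R2-C (blocked: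
`J < A(ē)`) / R2-I. -/
theorem residual_jstar (P P' : ι → V) (hPP' : ∀ X, P X ≠ P' X)
    (hinj : Function.Injective fun X => (s(P X, P' X) : Sym2 V)) (r : V) (F : Finset ι)
    (hforest : ∀ K ∈ F, ∀ I ∈ F, K < I → P' K ≠ P I ∧ P' K ≠ P' I) (dom : ι → V → ι)
    (hdom : ∀ X ∉ F, ∀ d, (P X = d ∨ P' X = d) →
      dom X d ∈ F ∧ (P (dom X d) = d ∨ P' (dom X d) = d) ∧
        (∀ u, (P (dom X d) = u ∨ P' (dom X d) = u) → (P X = u ∨ P' X = u) → u = d))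
    (S : Finset ι) {X : ι} (hXS : X ∈ S) (hXF : X ∉ F) (hXr : P X ≠ r ∧ P' X ≠ r)
    (hXadj : ∀ Y ∈ S, P Y = P X ∨ P Y = P' X ∨ P' Y = P X ∨ P' Y = P' X)
    (hnotri : ¬ ∃ a b c : V, a ≠ b ∧ a ≠ c ∧ b ≠ c ∧ a ≠ r ∧ b ≠ r ∧ c ≠ r ∧
      (∃ X ∈ S, (s(P X, P' X) : Sym2 V) = s(a, b)) ∧ (∃ Y ∈ S, (s(P Y, P' Y) : Sym2 V) = s(a, c)) ∧
        ∃ Z ∈ S, (s(P Z, P' Z) : Sym2 V) = s(b, c))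
    (hy : ¬ ((∀ I ∈ F, I ∉ S) ∨ ∃ a ∈ F, P a = r ∧ a ∈ S ∧ ∀ b ∈ F, b < a → b ∉ S))
    (hNR : ∀ Y ∈ S, Y ≠ X → (P Y ≠ r ∧ P' Y ≠ r) → ∀ p, (P X = p ∨ P' X = p) → (P Y ≠ p ∧ P' Y ≠ p) →
      (P (dom X p) = r ∨ P' (dom X p) = r))
    (hnadm : ∀ d, (P X = d ∨ P' X = d) → P (dom X d) = r → (∃ Y ∈ S, P Y ≠ d ∧ P' Y ≠ d) →
      (∀ μ ∈ insert (dom X d) (S.erase X), μ ∉ F → (P μ ≠ r ∧ P' μ ≠ r) →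
        ∃ j ∈ insert (dom X d) (S.erase X), ¬ (P j = P μ ∨ P j = P' μ ∨ P' j = P μ ∨ P' j = P' μ)) →
      ¬ ((∀ I ∈ F, I ∉ insert (dom X d) (S.erase X)) ∨
        ∃ a ∈ F, P a = r ∧ a ∈ insert (dom X d) (S.erase X) ∧ ∀ b ∈ F, b < a → b ∉ insert (dom X d) (S.erase X)))
    {J : ι} (hJS : J ∈ S) (hJF : J ∈ F) (hJmin : ∀ I ∈ S, I ∈ F → J ≤ I) :
    P J ≠ r ∧ ∃ e ē : V, ((P X = e ∧ P' X = ē) ∨ (P X = ē ∧ P' X = e)) ∧ (P J = e ∨ P' J = e) ∧ ¬ (P J = ē ∨ P' J = ē) ∧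
      ((P J = e ∧ P' J = r ∧ P (dom X ē) ≠ r ∧ P' (dom X ē) ≠ r) ∨
       (P J ≠ r ∧ P' J ≠ r ∧
        ((P (dom X ē) = r ∧ P' (dom X ē) = ē ∧ J < dom X ē) ∨ (P (dom X ē) = ē ∧ P' (dom X ē) = r)))) := by
  classical
  -- `J` is not a child edge
  have hJr : P J ≠ r := fun h => hy (Or.inr ⟨J, hJF, h, hJS, fun b hbF hbJ hbS => absurd (hJmin b hbS hbF) (not_le.2 hbJ)⟩)
  have hJX : J ≠ X := fun h => hXF (h ▸ hJF)
  refine ⟨hJr, ?_⟩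
  -- L4.2
  obtain ⟨e, ē, hX, hJe, hJē, hcase⟩ := jstar_structure P P' hPP' hinj r F dom hXF hXr hJF hJr (hXadj J hJS)
    (fun e ē s hX hJ hsē => by
      by_cases hsr : s = r
      · exact Or.inl hsr
      · right
        have her : e ≠ r := by
          rcases hX with ⟨h1, _⟩ | ⟨_, h2⟩
          · rw [← h1]; exact hXr.1
          · rw [← h2]; exact hXr.2
        have heē : e ≠ ē := by
          rcases hX with ⟨h1, h2⟩ | ⟨h1, h2⟩
          · rw [← h1, ← h2]; exact hPP' X
          · rw [← h1, ← h2]; exact (hPP' X).symm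
        have hJr' : P J ≠ r ∧ P' J ≠ r := by
          rcases hJ with ⟨h1, h2⟩ | ⟨h1, h2⟩
          · exact ⟨by rw [h1]; exact her, by rw [h2]; exact hsr⟩
          · exact ⟨by rw [h1]; exact hsr, by rw [h2]; exact her⟩
        have hJē' : P J ≠ ē ∧ P' J ≠ ē := by
          rcases hJ with ⟨h1, h2⟩ | ⟨h1, h2⟩
          · exact ⟨by rw [h1]; exact heē, by rw [h2]; exact hsē⟩
          · exact ⟨by rw [h1]; exact hsē, by rw [h2]; exact heē⟩
        have hēX : P X = ē ∨ P' X = ē := by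
          rcases hX with ⟨_, h2⟩ | ⟨h1, _⟩
          · exact Or.inr h2
          · exact Or.inl h1
        exact hNR J hJS hJX hJr' ē hēX hJē')
  refine ⟨e, ē, hX, hJe, hJē, ?_⟩
  have hēX : P X = ē ∨ P' X = ē := by
    rcases hX with ⟨_, h2⟩ | ⟨h1, _⟩
    · exact Or.inr h2
    · exact Or.inl h1
  have heē : e ≠ ē := by
    rcases hX with ⟨h1, h2⟩ | ⟨h1, h2⟩
    · rw [← h1, ← h2]; exact hPP' X
    · rw [← h1, ← h2]; exact (hPP' X).symm
  have hēr : ē ≠ r := by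
    rcases hX with ⟨_, h⟩ | ⟨h, _⟩
    · rw [← h]; exact hXr.2
    · rw [← h]; exact hXr.1
  obtain ⟨hDF, hDē, -⟩ := hdom X hXF ē hēX
  -- the swap at a C-hot far end `ē` is admissible unless blocked
  have hswap : P (dom X ē) = r →
      (∀ μ, μ ∉ F → (P μ ≠ r ∧ P' μ ≠ r) → μ ∈ S → μ ≠ X → (P μ = ē ∨ P' μ = ē) →
        ¬ (P J = P μ ∨ P J = P' μ ∨ P' J = P μ ∨ P' J = P' μ)) →
      (∀ I ∈ F, I ∈ S → dom X ē < I) → False := by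
    intro hChot hΦ3 hΦ4
    have hAē : P' (dom X ē) = ē := hDē.resolve_left fun h => hēr (h.symm.trans hChot)
    obtain ⟨hΩ, hy1⟩ := swap_target_cred P P' r F S hJS hJX hDF hChot hAē hΦ3 hΦ4
    refine hnadm ē hēX hChot ⟨J, hJS, ?_⟩ hΩ hy1
    exact ⟨fun h => hJē (Or.inl h), fun h => hJē (Or.inr h)⟩
  rcases hcase with ⟨hJe', hJ'r⟩ | ⟨hJr1, hJr2, hhot⟩
  · -- type I: `J = I₀`; the far end is cold
    left
    refine ⟨hJe', hJ'r, fun hChot => ?_, fun hIhot => ?_⟩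
    · obtain ⟨-, -, hΦ3, hΦ4⟩ := swap_admissible_I P P' hPP' hinj r F hforest dom hdom hXF hXr hX S hJF hJmin ⟨hJe', hJ'r⟩ hChot
      exact hswap hChot (fun μ hμF hμr _ hμX hμē => hΦ3 μ hμF hμr hμX hμē) hΦ4
    · -- `dom X ē` would be the leaf class `J`, which avoids `ē`
      have hDJ : dom X ē = J := leafClass_unique P P' r F hforest hDF hIhot hJF hJ'r
      rw [hDJ] at hDē
      exact hJē hDē
  · -- type H: `ē` is hot
    right
    refine ⟨hJr1, hJr2, ?_⟩
    rcases hhot with hChot | hIhot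
    · left
      have hAē : P' (dom X ē) = ē := hDē.resolve_left fun h => hēr (h.symm.trans hChot)
      refine ⟨hChot, hAē, ?_⟩
      by_contra hJA
      obtain ⟨-, hΦ3, hΦ4⟩ := swap_admissible_H P P' hPP' hinj r F dom hdom hXF hXr hX S hXS hJS hJmin ⟨hJr1, hJr2⟩ hJe hJē
        hChot hJA hnotri
      exact hswap hChot hΦ3 hΦ4
    · right
      exact ⟨hDē.resolve_right fun h => hēr (h.symm.trans hIhot), hIhot⟩

end StarSet

end Summit.CriticalPhenomena.PercolationContinuityZ3.Theorems
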